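/-
Copyright: statement-level skeleton of a published paper (lit-balaban cell, Phase-2 proof seat p25, gen 16). No proof
claims beyond what the kernel checks below.
-/
import Literature.MathematicalPhysics.QuantumFieldTheory.BalabanImbrieJaffe1984to88.BIJ88VertexComponents311

/-!
# `BalabanImbrieJaffe1984to88.BIJ88LabelledRun311` — T. Bałaban, J. Imbrie, A. Jaffe, *Effective action and cluster
properties of the abelian Higgs model*, Commun. Math. Phys. **114** (1988) 257–315 [BalabanImbrieJaffe1988], §5.14
p. 311–312 [PDF 55–56] *"We stop integrating by parts fields in complete components of X. After sufficiently many
integrations by parts, all components of X will be complete. We break up the observable according to the connected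
components of X. … We can arrange the construction so that the {X_c} are determined once the remainder components are
specified."* — **THE RUN OF ONE COMPONENT, LABELLED BY THE OBSERVABLES IT CONTAINS.**  The sequel of p25 gen 15's
`BIJ88VertexComponents311` (same six integration-by-parts events, same stopping rule `Grp.complete`), re-booked so that
print's sets `X_c`, `X_r` become definable and the resummation over the constant components provable (sibling files
`BIJ88LabelledExpansion311`, `BIJ88Resummation312`): a component carries the LABELS of the observables merged into it
(`LGrp.lab`), the observables not yet touched are an ENVIRONMENT `rest : Finset κ` (pristine components are created only
when touched), the complete components set aside are a MULTISET `done`, and `run` follows the current component until it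
is complete, returning every OUTCOME (coefficient, `χ′`-directions, vertices, the complete component, the environment
left).  Multisets instead of lists: no positional bookkeeping, so that the two ENVIRONMENT LEMMAS of the sibling
`BIJ88LabelledRunEnv311` — the outcomes that leave a sub-environment untouched are exactly the outcomes of the run in
the smaller environment, and constant outcomes do not see the complete components already set aside — are multiset
identities.

statement-level skeleton of published theorems with citation tags; proofs where landed; nothing here is a claim
about the Yang–Mills mass gap

PDF held: `paper:balaban1988-cmp114-bij-abelian-higgs-effective-action` (journal page = PDF page + 256); p. 311–312 =
PDF 55–56 (`p0055.txt` L23–38, `p0056.txt` L1–9 re-read this session).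

CITATION HEADER (lean-in-tree rule).  lit-balaban cell (HOME `run/shared/lean/pub/lit-balaban/`), Phase 2, seat p25
gen 16; row **C2.Claim@312** of `HOME/lit-balaban-r16/ROWS-C2-part2.md` (owner r16, referee ref-5; head untouched —
honest-scope item (c) of `BIJ88VertexComponents311`, the resummation, is what this file prepares).  USED BY NAME,
nothing restated: `BIJ88VertexComponents311.{Grp, Grp.complete, Grp.IsConst, Grp.IsRem, maxArity, length_legs_le,
Grp.nv_lt_of_not_complete, Grp.pend_ne_nil_of_not_complete}`.

## What is proved (0 `sorry`, standard axioms, no new `Prop` facts; definitions with bodies: `LGrp`, `pristine`,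
`LGrp.absorb`, `Outcome` (+ `scale`/`push`/`bump`), `fbind`, `mbind`, `rpot`, `run`)

* §1 labelled components and outcomes; the binders `fbind`/`mbind` (unions with multiplicity over the members of a
  finset / multiset, the membership proof passed to the family — the well-founded recursion must see `j ∈ rest`,
  `h ∈ done`) with their bookkeeping (`mem_`, `filter_`, `map_`, `_congr`, `fbind_eq_bind`, `fbind_eq_fbind_subset`,
  `sum_map_fbind`, `sum_map_mbind`, `sum_map_bind`, `mbind_eq_zero`, `bind_eq_zero`).
* §2 the potential `rpot` and its decrease lemmas (`rpot_pair`, `rpot_pristine`, `rpot_absorb`, `rpot_drop`,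
  `rpot_vertex`); **`run`** (well-founded on `rpot`): complete ⇒ the single outcome "set aside"; otherwise the head
  leg contracts (1) within the component, (2) to a leg of a pristine observable `j ∈ rest` [it joins, labels
  `∪ {j}`], (3) to a pending leg of a complete component in `done` [it joins, labels and counts add], (4) to the
  source, (5) to `χ′` [count +1, direction recorded], (6) to a vertex [its other legs join, vertex count +1];
  §2b the unfolding lemmas `run_of_complete`, `run_of_not_complete`.
HONEST SCOPE: as in `BIJ88VertexComponents311` — contraction-graph components, one covariance (no random-walk trigger,
no `C_loc` split), a fixed order of events inside a component (head leg first); the analytic identity (nothing is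
lost) is the sibling `BIJ88LabelledExpansion311`; no estimates here.  NOT summit progress; NOT continuum; NOT Clay.
Imports `BIJ88VertexComponents311` only; modifies nothing.
-/

noncomputable section

namespace Literature.MathematicalPhysics.QuantumFieldTheory.BalabanImbrieJaffe1984to88.BIJ88LabelledRun311

open Classical Matrix Finset
open scoped BigOperators
open BIJ88VertexComponents311 (Grp maxArity length_legs_le)

variable {S : Type} [Fintype S] {ι : Type} [Fintype ι] {κ : Type}

/-! ## §1  Labelled components and outcomes -/

/-- **A component labelled by the observables it contains** (p. 311 *"We break up the observable according to the
connected components of X"*): the component's pending legs and counts (`Grp`) and the set of observables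
`F_{k,loc}(X_{σ_i})` merged into it. [cite: BalabanImbrieJaffe1988, §5.14 p.311] -/
structure LGrp (S κ : Type) extends Grp S where
  /-- the observables (indices) whose legs belong to this component -/
  lab : Finset κ

/-- The pristine component of the observable `j`: its legs, no `χ′`, no vertex, label `{j}`.
[cite: BalabanImbrieJaffe1988, §5.14 p.311] -/
def pristine (obs : κ → List (S → ℝ)) (j : κ) : LGrp S κ := ⟨⟨obs j, 0, 0⟩, {j}⟩

/-- **Two components joined by a contraction** (the head leg of the first contracts to the `i`-th pending leg of the
second): legs, counts and labels are united. [cite: BalabanImbrieJaffe1988, §5.14 p.311] -/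
def LGrp.absorb [DecidableEq κ] (L : List (S → ℝ)) (g h : LGrp S κ) (i : ℕ) : LGrp S κ :=
  ⟨⟨L ++ h.pend.eraseIdx i, g.nchi + h.nchi, g.nv + h.nv⟩, g.lab ∪ h.lab⟩

/-- **An outcome of the run of one component**: the product of the contraction weights, the `χ′`-directions produced
(earliest first), the number of vertices differentiated down, the component once complete, the untouched observables
and the untouched complete components. [cite: BalabanImbrieJaffe1988, §5.14 p.311–312] -/
structure Outcome (S κ : Type) where
  /-- product of the contraction weights of the run -/
  a : ℝ
  /-- directions of the contractions to `χ′` made in the run, earliest first -/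
  D : List (S → ℝ)
  /-- vertices differentiated down in the run -/
  dv : ℕ
  /-- the component, complete -/
  g : LGrp S κ
  /-- observables not touched -/
  rest : Finset κ
  /-- complete components set aside earlier and not touched -/
  done : Multiset (LGrp S κ)

/-- Multiply the weight (bookkeeping). [cite: BalabanImbrieJaffe1988, §5.14 p.311] -/
@[simps] def Outcome.scale (w : ℝ) (o : Outcome S κ) : Outcome S κ := { o with a := w * o.a }

/-- Record an earlier `χ′`-direction (bookkeeping). [cite: BalabanImbrieJaffe1988, §5.14 p.311] -/
@[simps] def Outcome.push (z : S → ℝ) (o : Outcome S κ) : Outcome S κ := { o with D := z :: o.D }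

/-- Record an earlier vertex (bookkeeping). [cite: BalabanImbrieJaffe1988, §5.14 p.311] -/
@[simps] def Outcome.bump (o : Outcome S κ) : Outcome S κ := { o with dv := o.dv + 1 }


/-! ### Binders with membership (the well-founded recursion must see `j ∈ rest`, `h ∈ done`) -/

section Bind

variable {α X Y : Type}

/-- `⋃_{j ∈ s} F j` with multiplicity, the membership proof passed to the family (the union over the
integration-by-parts targets among the untouched observables). [cite: BalabanImbrieJaffe1988, §5.14 p.311] -/
def fbind (s : Finset α) (F : (j : α) → j ∈ s → Multiset X) : Multiset X := s.attach.val.bind fun j => F j.1 j.2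

/-- `⋃_{a ∈ m} F a` with multiplicity, the membership proof passed to the family (the union over the
integration-by-parts targets among the complete components set aside). [cite: BalabanImbrieJaffe1988, §5.14 p.311] -/
def mbind (m : Multiset α) (F : (a : α) → a ∈ m → Multiset X) : Multiset X := m.attach.bind fun a => F a.1 a.2

omit [Fintype S] in
/-- Membership in `fbind` (bookkeeping). [cite: BalabanImbrieJaffe1988, §5.14 p.311] -/
theorem mem_fbind {s : Finset α} {F : (j : α) → j ∈ s → Multiset X} {x : X} :
    x ∈ fbind s F ↔ ∃ j, ∃ hj : j ∈ s, x ∈ F j hj := by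
  simp only [fbind, Multiset.mem_bind, Finset.mem_val, Finset.mem_attach, true_and, Subtype.exists]

omit [Fintype S] in
/-- Membership in `mbind` (bookkeeping). [cite: BalabanImbrieJaffe1988, §5.14 p.311] -/
theorem mem_mbind {m : Multiset α} {F : (a : α) → a ∈ m → Multiset X} {x : X} :
    x ∈ mbind m F ↔ ∃ a, ∃ ha : a ∈ m, x ∈ F a ha := by
  simp only [mbind, Multiset.mem_bind, Multiset.mem_attach, true_and, Subtype.exists]

omit [Fintype S] in
/-- `filter` through `Multiset.bind` (bookkeeping). [cite: BalabanImbrieJaffe1988, §5.14 p.311] -/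
theorem filter_bind (p : X → Prop) [DecidablePred p] (m : Multiset α) (F : α → Multiset X) :
    (m.bind F).filter p = m.bind fun a => (F a).filter p := by
  induction m using Multiset.induction_on with
  | empty => simp
  | cons a m ih => rw [Multiset.cons_bind, Multiset.cons_bind, Multiset.filter_add, ih]

omit [Fintype S] in
/-- `filter` through `fbind` (bookkeeping). [cite: BalabanImbrieJaffe1988, §5.14 p.311] -/
theorem filter_fbind (p : X → Prop) [DecidablePred p] (s : Finset α) (F : (j : α) → j ∈ s → Multiset X) :
    (fbind s F).filter p = fbind s fun j hj => (F j hj).filter p :=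
  filter_bind p _ _

omit [Fintype S] in
/-- `filter` through `mbind` (bookkeeping). [cite: BalabanImbrieJaffe1988, §5.14 p.311] -/
theorem filter_mbind (p : X → Prop) [DecidablePred p] (m : Multiset α) (F : (a : α) → a ∈ m → Multiset X) :
    (mbind m F).filter p = mbind m fun a ha => (F a ha).filter p :=
  filter_bind p _ _

omit [Fintype S] in
/-- `map` through `fbind` (bookkeeping). [cite: BalabanImbrieJaffe1988, §5.14 p.311] -/
theorem map_fbind (v : X → Y) (s : Finset α) (F : (j : α) → j ∈ s → Multiset X) :
    (fbind s F).map v = fbind s fun j hj => (F j hj).map v :=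
  Multiset.map_bind _ _ _

omit [Fintype S] in
/-- `map` through `mbind` (bookkeeping). [cite: BalabanImbrieJaffe1988, §5.14 p.311] -/
theorem map_mbind (v : X → Y) (m : Multiset α) (F : (a : α) → a ∈ m → Multiset X) :
    (mbind m F).map v = mbind m fun a ha => (F a ha).map v :=
  Multiset.map_bind _ _ _

omit [Fintype S] in
/-- Pointwise-equal families give the same `fbind` (bookkeeping). [cite: BalabanImbrieJaffe1988, §5.14 p.311] -/
theorem fbind_congr {s : Finset α} {F G : (j : α) → j ∈ s → Multiset X} (h : ∀ j (hj : j ∈ s), F j hj = G j hj) :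
    fbind s F = fbind s G := by
  unfold fbind
  exact Multiset.bind_congr (fun j _ => h j.1 j.2)

omit [Fintype S] in
/-- Pointwise-equal families give the same `mbind` (bookkeeping). [cite: BalabanImbrieJaffe1988, §5.14 p.311] -/
theorem mbind_congr {m : Multiset α} {F G : (a : α) → a ∈ m → Multiset X} (h : ∀ a (ha : a ∈ m), F a ha = G a ha) :
    mbind m F = mbind m G := by
  unfold mbind
  exact Multiset.bind_congr (fun a _ => h a.1 a.2)

omit [Fintype S] in
/-- `mbind` over no component (bookkeeping). [cite: BalabanImbrieJaffe1988, §5.14 p.311] -/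
@[simp] theorem mbind_zero (F : (a : α) → a ∈ (0 : Multiset α) → Multiset X) : mbind 0 F = 0 := by
  simp [mbind]

omit [Fintype S] in
/-- An `mbind` of a vanishing family vanishes (bookkeeping). [cite: BalabanImbrieJaffe1988, §5.14 p.311] -/
theorem mbind_eq_zero {m : Multiset α} {F : (a : α) → a ∈ m → Multiset X} (h : ∀ a (ha : a ∈ m), F a ha = 0) :
    mbind m F = 0 :=
  (Multiset.bind_congr (g := fun _ => (0 : Multiset X)) fun a _ => h a.1 a.2).trans (Multiset.bind_zero _)

omit [Fintype S] in
/-- A `bind` of a vanishing family vanishes (bookkeeping). [cite: BalabanImbrieJaffe1988, §5.14 p.311] -/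
theorem bind_eq_zero {m : Multiset α} {F : α → Multiset X} (h : ∀ a ∈ m, F a = 0) : m.bind F = 0 :=
  (Multiset.bind_congr (g := fun _ => (0 : Multiset X)) h).trans (Multiset.bind_zero _)

omit [Fintype S] in
/-- `fbind` forgets the membership proofs (bookkeeping). [cite: BalabanImbrieJaffe1988, §5.14 p.311] -/
theorem fbind_eq_bind (s : Finset α) (F : (j : α) → j ∈ s → Multiset X) (G : α → Multiset X)
    (h : ∀ j (hj : j ∈ s), F j hj = G j) : fbind s F = s.val.bind G := by
  unfold fbind
  rw [Multiset.bind_congr (g := fun j : {j // j ∈ s} => G j.1) (fun j _ => h j.1 j.2),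
    ← Multiset.bind_map s.attach.val G Subtype.val]
  exact congrArg (fun m => Multiset.bind m G) (Multiset.attach_map_val s.val)

omit [Fintype S] in
/-- An `fbind` whose family vanishes off `B ⊆ s` is the `fbind` over `B` (bookkeeping). [cite: BalabanImbrieJaffe1988, §5.14 p.311] -/
theorem fbind_eq_fbind_subset [DecidableEq α] {s B : Finset α} (hB : B ⊆ s) (F : (j : α) → j ∈ s → Multiset X)
    (G : α → Multiset X) (hG : ∀ j (hj : j ∈ s), F j hj = G j) (h0 : ∀ j ∈ s, j ∉ B → G j = 0) :
    fbind s F = fbind B fun j hj => F j (hB hj) := by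
  rw [fbind_eq_bind s F G hG, fbind_eq_bind B _ G (fun j hj => hG j (hB hj))]
  have hs : s = B.disjUnion (s \ B) Finset.disjoint_sdiff := by
    rw [Finset.disjUnion_eq_union, Finset.union_sdiff_of_subset hB]
  conv_lhs => rw [hs]
  rw [Finset.disjUnion_val, Multiset.add_bind, add_eq_left]
  refine (Multiset.bind_congr (g := fun _ => (0 : Multiset X)) fun j hj => ?_).trans (Multiset.bind_zero _)
  have hj' : j ∈ s \ B := hj
  rw [Finset.mem_sdiff] at hj'
  exact h0 j hj'.1 hj'.2

omit [Fintype S] in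
/-- A sum over `fbind` is an iterated sum (bookkeeping). [cite: BalabanImbrieJaffe1988, §5.14 p.311] -/
theorem sum_map_fbind [AddCommMonoid Y] (v : X → Y) (s : Finset α) (F : (j : α) → j ∈ s → Multiset X) :
    ((fbind s F).map v).sum = ∑ j ∈ s.attach, ((F j.1 j.2).map v).sum := by
  simp only [fbind, Multiset.map_bind, Multiset.sum_bind, Finset.sum_eq_multiset_sum]

omit [Fintype S] in
/-- A sum over `mbind` is an iterated sum (bookkeeping). [cite: BalabanImbrieJaffe1988, §5.14 p.311] -/
theorem sum_map_mbind [AddCommMonoid Y] (v : X → Y) (m : Multiset α) (F : (a : α) → a ∈ m → Multiset X) :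
    ((mbind m F).map v).sum = (m.attach.map fun a => ((F a.1 a.2).map v).sum).sum := by
  simp only [mbind, Multiset.map_bind, Multiset.sum_bind]

omit [Fintype S] in
/-- A sum over a `bind` is an iterated sum (bookkeeping). [cite: BalabanImbrieJaffe1988, §5.14 p.311] -/
theorem sum_map_bind [AddCommMonoid Y] (v : X → Y) (s : Finset α) (F : α → Multiset X) :
    ((s.val.bind F).map v).sum = ∑ j ∈ s, ((F j).map v).sum := by
  simp only [Multiset.map_bind, Multiset.sum_bind, Finset.sum_eq_multiset_sum]

end Bind

/-! ## §2  The potential and the run -/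

/-- The termination potential of a run: pending legs of the component (+1, + the arity budget of the vertices it may
still differentiate down), the legs of the untouched observables, the pending legs of the complete components.
[cite: BalabanImbrieJaffe1988, §5.14 p.311] -/
def rpot (obs : κ → List (S → ℝ)) (M A : ℕ) (g : LGrp S κ) (rest : Finset κ) (done : Multiset (LGrp S κ)) : ℕ :=
  g.pend.length + 1 + (M - g.nv) * A + (∑ j ∈ rest, (obs j).length) + (done.map fun h => h.pend.length).sum

section Pot

variable (obs : κ → List (S → ℝ)) (M A : ℕ) {g : LGrp S κ} {u : S → ℝ} {L : List (S → ℝ)}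
  (rest : Finset κ) (done : Multiset (LGrp S κ))

omit [Fintype S] in
/-- (1) a contraction inside the component lowers the potential. [cite: BalabanImbrieJaffe1988, §5.14 p.311] -/
theorem rpot_pair (hp : g.pend = u :: L) (i : ℕ) :
    rpot obs M A ⟨⟨L.eraseIdx i, g.nchi, g.nv⟩, g.lab⟩ rest done < rpot obs M A g rest done := by
  have := List.length_eraseIdx_le L i
  simp only [rpot, hp, List.length_cons]
  omega

omit [Fintype S] in
/-- (2) joining a pristine observable lowers the potential. [cite: BalabanImbrieJaffe1988, §5.14 p.311] -/
theorem rpot_pristine [DecidableEq κ] (hp : g.pend = u :: L) {j : κ} (hj : j ∈ rest) (i : ℕ) (lab' : Finset κ) :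
    rpot obs M A ⟨⟨L ++ (obs j).eraseIdx i, g.nchi, g.nv⟩, lab'⟩ (rest.erase j) done < rpot obs M A g rest done := by
  have h1 := List.length_eraseIdx_le (obs j) i
  have h2 := Finset.add_sum_erase rest (fun j => (obs j).length) hj
  simp only [rpot, hp, List.length_cons, List.length_append]
  omega

omit [Fintype S] in
/-- (3) joining a complete component lowers the potential. [cite: BalabanImbrieJaffe1988, §5.14 p.311] -/
theorem rpot_absorb [DecidableEq κ] (hp : g.pend = u :: L) {h : LGrp S κ} (hh : h ∈ done) (i : ℕ) :
    rpot obs M A (LGrp.absorb L g h i) rest (done.erase h) < rpot obs M A g rest done := by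
  have h1 := List.length_eraseIdx_le h.pend i
  have h2 : (done.map fun h => h.pend.length).sum
      = h.pend.length + ((done.erase h).map fun h => h.pend.length).sum := by
    conv_lhs => rw [← Multiset.cons_erase hh]
    rw [Multiset.map_cons, Multiset.sum_cons]
  have h3 : (M - (g.nv + h.nv)) * A ≤ (M - g.nv) * A :=
    Nat.mul_le_mul_right _ (Nat.sub_le_sub_left (Nat.le_add_right _ _) _)
  simp only [rpot, hp, List.length_cons, LGrp.absorb, List.length_append]
  omega

omit [Fintype S] in
/-- (4)/(5) a contraction to the source or to `χ′` lowers the potential. [cite: BalabanImbrieJaffe1988, §5.14 p.311] -/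
theorem rpot_drop (hp : g.pend = u :: L) (n : ℕ) :
    rpot obs M A ⟨⟨L, n, g.nv⟩, g.lab⟩ rest done < rpot obs M A g rest done := by
  simp only [rpot, hp, List.length_cons]
  omega

omit [Fintype S] in
/-- (6) differentiating down a vertex (fewer than `M` so far) lowers the potential. [cite: BalabanImbrieJaffe1988, §5.14 p.311] -/
theorem rpot_vertex (legs : ι → List (S → ℝ)) (hp : g.pend = u :: L) (hnv : g.nv < M) (m : ι) (j : ℕ) :
    rpot obs M (maxArity legs) ⟨⟨L ++ (legs m).eraseIdx j, g.nchi, g.nv + 1⟩, g.lab⟩ rest done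
      < rpot obs M (maxArity legs) g rest done := by
  have e : M - g.nv = (M - (g.nv + 1)) + 1 := by omega
  have h1 := List.length_eraseIdx_le (legs m) j
  have h2 := length_legs_le legs m
  simp only [rpot, hp, List.length_cons, List.length_append, e, Nat.add_mul, one_mul]
  omega

end Pot

variable [DecidableEq S] [DecidableEq κ]

/-- **THE RUN OF ONE COMPONENT** (p. 311): follow the component `g` in the environment (`rest` = untouched observables,
`done` = complete components set aside) until it is complete — *"We stop integrating by parts fields in complete
components of X"* — and return every outcome.  If `g` is complete: the single outcome "set aside".  Otherwise its head
leg `Φ(u)` is integrated by parts and contracts (1) to another pending leg of `g`; (2) to the `i`-th leg of a pristine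
observable `j ∈ rest`, which JOINS the component (label `j` added); (3) to the `i`-th pending leg of a complete
component `h ∈ done`, which JOINS (labels and counts add); (4) to the source `ℱ`; (5) to `χ′` (count `+1`: complete;
direction `A⁻¹u` recorded); (6) to the vertex `m` through its leg `j` (its other legs join, vertex count `+1`).
Well-founded on `rpot` (*"After sufficiently many integrations by parts, all components of X will be complete"*).
[cite: BalabanImbrieJaffe1988, §5.14 p.311] -/
def run (A : Matrix S S ℝ) (f : S → ℝ) (c : ι → ℝ) (legs : ι → List (S → ℝ)) (obs : κ → List (S → ℝ)) (M : ℕ) :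
    LGrp S κ → Finset κ → Multiset (LGrp S κ) → Multiset (Outcome S κ)
  | g, rest, done =>
    if _hc : g.complete M = true then {⟨1, [], 0, g, rest, done⟩}
    else
      match _hp : g.pend with
      | [] => 0
      | u :: L =>
        -- (1) to another pending leg of the same component
        ((range L.length).val.bind fun i =>
          (run A f c legs obs M ⟨⟨L.eraseIdx i, g.nchi, g.nv⟩, g.lab⟩ rest done).map
            (Outcome.scale ((A⁻¹ *ᵥ u) ⬝ᵥ L.getD i 0)))
        -- (2) to a leg of a pristine observable: it joins the component
        + (fbind rest fun j _hj => (range (obs j).length).val.bind fun i =>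
            (run A f c legs obs M ⟨⟨L ++ (obs j).eraseIdx i, g.nchi, g.nv⟩, g.lab ∪ {j}⟩ (rest.erase j) done).map
              (Outcome.scale ((A⁻¹ *ᵥ u) ⬝ᵥ (obs j).getD i 0)))
        -- (3) to a pending leg of a complete component set aside: it joins the component
        + (mbind done fun h _hh => (range h.pend.length).val.bind fun i =>
            (run A f c legs obs M (LGrp.absorb L g h i) rest (done.erase h)).map
              (Outcome.scale ((A⁻¹ *ᵥ u) ⬝ᵥ h.pend.getD i 0)))
        -- (4) to the source
        + (run A f c legs obs M ⟨⟨L, g.nchi, g.nv⟩, g.lab⟩ rest done).map (Outcome.scale ((A⁻¹ *ᵥ u) ⬝ᵥ f))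
        -- (5) to χ′
        + (run A f c legs obs M ⟨⟨L, g.nchi + 1, g.nv⟩, g.lab⟩ rest done).map (Outcome.push (A⁻¹ *ᵥ u))
        -- (6) to the interaction: a vertex differentiated down, its other legs join the component
        + ((univ : Finset ι).val.bind fun m => (range (legs m).length).val.bind fun j =>
            (run A f c legs obs M ⟨⟨L ++ (legs m).eraseIdx j, g.nchi, g.nv + 1⟩, g.lab⟩ rest done).map
              fun o => (o.scale (-(c m * ((A⁻¹ *ᵥ u) ⬝ᵥ (legs m).getD j 0)))).bump)
  termination_by g rest done => rpot obs M (maxArity legs) g rest done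
  decreasing_by
    · exact rpot_pair obs M _ rest done _hp i
    · exact rpot_pristine obs M _ rest done _hp _hj i _
    · exact rpot_absorb obs M _ rest done _hp _hh i
    · exact rpot_drop obs M _ rest done _hp _
    · exact rpot_drop obs M _ rest done _hp _
    · exact rpot_vertex obs M rest done legs _hp (Grp.nv_lt_of_not_complete _hc) m j


/-! ## §2b  Unfolding the run -/

section Unfold


variable (A : Matrix S S ℝ) (f : S → ℝ) (c : ι → ℝ) (legs : ι → List (S → ℝ)) (obs : κ → List (S → ℝ)) (M : ℕ)

/-- Unfolding the run of a complete component: it is set aside. [cite: BalabanImbrieJaffe1988, §5.14 p.311] -/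
theorem run_of_complete {g : LGrp S κ} (hc : g.complete M = true) (rest : Finset κ) (done : Multiset (LGrp S κ)) :
    run A f c legs obs M g rest done = {⟨1, [], 0, g, rest, done⟩} := by
  rw [run, dif_pos hc]

/-- Unfolding the run of an incomplete component with head leg `u`: the six contractions.
[cite: BalabanImbrieJaffe1988, §5.14 p.311] -/
theorem run_of_not_complete {g : LGrp S κ} (hc : ¬ g.complete M = true) {u : S → ℝ} {L : List (S → ℝ)}
    (hp : g.pend = u :: L) (rest : Finset κ) (done : Multiset (LGrp S κ)) :
    run A f c legs obs M g rest done
      = ((range L.length).val.bind fun i =>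
          (run A f c legs obs M ⟨⟨L.eraseIdx i, g.nchi, g.nv⟩, g.lab⟩ rest done).map
            (Outcome.scale ((A⁻¹ *ᵥ u) ⬝ᵥ L.getD i 0)))
        + (fbind rest fun j _hj => (range (obs j).length).val.bind fun i =>
            (run A f c legs obs M ⟨⟨L ++ (obs j).eraseIdx i, g.nchi, g.nv⟩, g.lab ∪ {j}⟩ (rest.erase j) done).map
              (Outcome.scale ((A⁻¹ *ᵥ u) ⬝ᵥ (obs j).getD i 0)))
        + (mbind done fun h _hh => (range h.pend.length).val.bind fun i =>
            (run A f c legs obs M (LGrp.absorb L g h i) rest (done.erase h)).map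
              (Outcome.scale ((A⁻¹ *ᵥ u) ⬝ᵥ h.pend.getD i 0)))
        + (run A f c legs obs M ⟨⟨L, g.nchi, g.nv⟩, g.lab⟩ rest done).map (Outcome.scale ((A⁻¹ *ᵥ u) ⬝ᵥ f))
        + (run A f c legs obs M ⟨⟨L, g.nchi + 1, g.nv⟩, g.lab⟩ rest done).map (Outcome.push (A⁻¹ *ᵥ u))
        + ((univ : Finset ι).val.bind fun m => (range (legs m).length).val.bind fun j =>
            (run A f c legs obs M ⟨⟨L ++ (legs m).eraseIdx j, g.nchi, g.nv + 1⟩, g.lab⟩ rest done).map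
              fun o => (o.scale (-(c m * ((A⁻¹ *ᵥ u) ⬝ᵥ (legs m).getD j 0)))).bump) := by
  rw [run, dif_neg hc]
  split
  · rename_i h0
    rw [hp] at h0
    exact absurd h0 (List.cons_ne_nil _ _)
  · rename_i u' L' hp'
    rw [hp] at hp'
    obtain ⟨rfl, rfl⟩ := List.cons_eq_cons.1 hp'
    rfl

end Unfold

end Literature.MathematicalPhysics.QuantumFieldTheory.BalabanImbrieJaffe1984to88.BIJ88LabelledRun311

end
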